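import Mathlib
import Summits.NavierStokesRegularity.NavierStokesRegularity.Theorems.FilamentSkeletonRssSkeletonJ1LSplit

/-!
# `TangentSkeletonNearStraightL` (stmt-NavierStokesRegularity-23320, the heart of `SkeletonJ1L` 23296) — DATUM REDUCTION

Two structural facts about the child crux / registered stub `stub_tangentSkeletonL` of the skeleton of record `near_straight_newton_L`
(542f85c6fea9456b) of `SkeletonJ1L`, read off the TEXT of the route decl (`route_tangentSkeletonNearStraightL_iff`, landed p667381):

1. `straightDatum_two_le` — a straight skew datum (`StraightDatum`, the ∀-hypothesis of the child) has AT LEAST TWO lines: for `N = 1` the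
   closed-form scaled slip is `W(s) = s/2 + const` (no partner sum; `⟪e₃ × t, t⟫ = 0`), so `W′ ≡ 1/2 < 3/2 + δ` contradicts the transversal
   supercritical zero the datum demands.  (The waist stretching of every datum comes from a PARTNER's strain.)
2. `tangentSkeletonNearStraightL_of_core` — the conclusion of the child uses the datum `(p, t, s₀, W)` ONLY through `N`, the parameters `(γ, α)`
   and their box `θd ≤ |α|, |γ_j| ≤ θd⁻¹`: the child FOLLOWS from the datum-free core statement «for every `N ≥ 2`, every `θd > 0` and every
   `(γ, α)` in the `θd`-box there are box constants and `Rb₁ > 0` such that for all `0 < Rb ≤ Rb₁` and all `Γ ≥ Γ₂(Rb)` a rigid-core skeleton with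
   `FlatJ1L ∧ NearStraightJ1G` exists».  So the «shadowing of the straight datum» in the informal text is not part of the typed claim; a line for
   23320 is free to build its skeleton from any seed (the datum is a CERTIFICATE that `(N, γ, α)` is admissible, nothing more), and the restriction
   `N ≥ 2` is free by item 1.
3. (appended) the same reduction for the A1G heart `TangentSkeletonNearStraight` (28295; `FlatJ1G`), through which `SkeletonJ1` (27413) is reached.
Pure logic + one derivative; `--supports stmt-NavierStokesRegularity-23320` (stub `stub_tangentSkeletonL` of 23296 by name = this item).
HONEST FRAMING: bookkeeping about a HYPOTHETICAL filament skeleton on the NEGATIVE side of a MODEL route; `TangentSkeletonNearStraightL` and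
`SkeletonJ1L` stay OPEN; nothing here bears on Navier–Stokes regularity or blow-up.
-/

set_option linter.dupNamespace false

noncomputable section

namespace Summit.NavierStokesRegularity.NavierStokesRegularity.Theorems.TangentSkeletonLDatumReduction

open Literature.Analysis.FluidPDE
open Summit.NavierStokesRegularity.NavierStokesRegularity.Theorems.FilamentSkeletonRssSkeletonJ1GSplit
  (StraightDatum NearStraightJ1G FlatJ1G TangentSkeletonNearStraight route_tangentSkeletonNearStraight_iff)
open Summit.NavierStokesRegularity.NavierStokesRegularity.Theorems.FilamentSkeletonRssSkeletonJ1LSplit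
open scoped InnerProductSpace BigOperators

/-- The parameter box carried by a straight datum: `θd ≤ |α| ≤ θd⁻¹` and `θd ≤ |γ_j| ≤ θd⁻¹`. [folklore] -/
theorem straightDatum_paramBox {N : ℕ} {δd ρd Λd Rwd θd mw : ℝ} {p t : Fin N → EuclideanSpace ℝ (Fin 3)} {γ : Fin N → ℝ}
    {α : ℝ} {s₀ : Fin N → ℝ} (h : StraightDatum N δd ρd Λd Rwd θd mw p t γ α s₀) :
    θd ≤ |α| ∧ |α| ≤ θd⁻¹ ∧ ∀ j, θd ≤ |γ j| ∧ |γ j| ≤ θd⁻¹ :=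
  h.2.2.2.1

/-- **A straight skew datum has at least two lines.**  For `N = 1` the closed-form slip of the datum is affine with slope `1/2`
(`⟪e₃ × t, t⟫ = 0`, empty partner sum), which contradicts `3/2 + δd ≤ W′(s₀)` for `δd > 0`. [folklore] -/
theorem straightDatum_two_le {N : ℕ} {δd ρd Λd Rwd θd mw : ℝ} {p t : Fin N → EuclideanSpace ℝ (Fin 3)} {γ : Fin N → ℝ}
    {α : ℝ} {s₀ : Fin N → ℝ} (hδ : 0 < δd) (hN : 0 < N) (h : StraightDatum N δd ρd Λd Rwd θd mw p t γ α s₀) :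
    2 ≤ N := by
  by_contra hlt
  push Not at hlt
  obtain rfl : N = 1 := by omega
  obtain ⟨ht, -, -, -, -, hW⟩ := h
  -- the closed-form slip of the datum, as a function
  set W : Fin 1 → ℝ → ℝ := fun j s => ⟪(∑ k ∈ Finset.univ.erase j, (γ k / (2 * Real.pi)) •
      ((‖(p j + s • t j - p k) - ⟪p j + s • t j - p k, t k⟫_ℝ • t k‖ ^ 2)⁻¹ •
        cross (t k) ((p j + s • t j - p k) - ⟪p j + s • t j - p k, t k⟫_ℝ • t k))) +
      (1 / 2 : ℝ) • (p j + s • t j) - α • cross (EuclideanSpace.single 2 1) (p j + s • t j), t j⟫_ℝ with hWdef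
  have h32 : 3 / 2 + δd ≤ deriv (W 0) (s₀ 0) := (hW W (fun j s => rfl) 0).2.2.1
  -- for a single line the partner sum is empty and `W 0` is affine with slope `1/2`
  have hempty : Finset.univ.erase (0 : Fin 1) = ∅ := by decide
  have hperp : ⟪cross (EuclideanSpace.single 2 1) (t 0), t 0⟫_ℝ = 0 := by
    simp [cross, crossProduct, PiLp.inner_apply, Fin.sum_univ_three]; ring
  have htt : ⟪t 0, t 0⟫_ℝ = 1 := by
    rw [real_inner_self_eq_norm_sq, ht 0]; norm_num
  have hcross : ∀ s : ℝ, cross (EuclideanSpace.single 2 1) (p 0 + s • t 0) =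
      cross (EuclideanSpace.single 2 1) (p 0) + s • cross (EuclideanSpace.single 2 1) (t 0) := fun s => by
    simp [cross, map_add, map_smul]
  have haff : W 0 = fun s => ((1 / 2 : ℝ) * ⟪p 0, t 0⟫_ℝ - α * ⟪cross (EuclideanSpace.single 2 1) (p 0), t 0⟫_ℝ) + s * (1 / 2) := by
    funext s
    simp only [hWdef, hempty, Finset.sum_empty, hcross, smul_add, inner_sub_left, inner_add_left, inner_zero_left,
      real_inner_smul_left, hperp, htt]
    ring
  have hder : deriv (W 0) (s₀ 0) = 1 / 2 := by
    rw [haff]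
    exact ((((hasDerivAt_id (s₀ 0)).mul_const (1 / 2 : ℝ)).const_add _).deriv).trans (by ring)
  linarith

/-- **DATUM REDUCTION for the structured child `TangentSkeletonNearStraightLS`.**  The datum-free core existence statement (for every
`N ≥ 2`, every `θd > 0`, every `(γ, α)` in the `θd`-box: box constants, a tolerance ceiling `Rb₁`, and for all `0 < Rb ≤ Rb₁`, all large `Γ`,
a skeleton with `FlatJ1L ∧ NearStraightJ1G`) implies the child: the datum enters only through `N`, `(γ, α)` and the box, and `N ≥ 2` by
`straightDatum_two_le`. [folklore] -/
theorem tangentSkeletonNearStraightLS_of_core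
    (hcore : ∀ (N : ℕ) (θd : ℝ) (γ : Fin N → ℝ) (α : ℝ), 2 ≤ N → 0 < θd →
      (θd ≤ |α| ∧ |α| ≤ θd⁻¹ ∧ ∀ j, θd ≤ |γ j| ∧ |γ j| ≤ θd⁻¹) →
      ∃ (δ ρ K Λ Rw cg θ₀ KA Rb₁ : ℝ), 0 < δ ∧ 0 < ρ ∧ 0 < Rw ∧ 0 < cg ∧ 0 < θ₀ ∧ 0 < Rb₁ ∧
        2 * K * ρ ≤ 1 ∧ ∀ Rb : ℝ, 0 < Rb → Rb ≤ Rb₁ → ∃ Γ₂ : ℝ, ∀ Γ : ℝ, Γ₂ ≤ Γ →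
          ∃ (X : Fin N → ℝ → EuclideanSpace ℝ (Fin 3)) (w : Fin N → ℝ → ℝ) (c : Fin N → ℝ) (Aa : Fin N → ℝ → ℝ),
            FlatJ1L N δ ρ K Λ Rw Rb cg θ₀ KA Γ γ α X w c Aa ∧ NearStraightJ1G N Λ Rb X w Aa) :
    TangentSkeletonNearStraightLS := by
  intro N δd ρd Λd Rwd θd mw p t γ α s₀ hN hδ hρ hRw hθ hmw hSD hGP
  exact hcore N θd γ α (straightDatum_two_le hδ hN hSD) hθ (straightDatum_paramBox hSD)

/-- **DATUM REDUCTION for the route child `TangentSkeletonNearStraightL` (stmt-23320) BY NAME** — the same statement transported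
through the definitional certificate `route_tangentSkeletonNearStraightL_iff`. [folklore] -/
theorem tangentSkeletonNearStraightL_of_core
    (hcore : ∀ (N : ℕ) (θd : ℝ) (γ : Fin N → ℝ) (α : ℝ), 2 ≤ N → 0 < θd →
      (θd ≤ |α| ∧ |α| ≤ θd⁻¹ ∧ ∀ j, θd ≤ |γ j| ∧ |γ j| ≤ θd⁻¹) →
      ∃ (δ ρ K Λ Rw cg θ₀ KA Rb₁ : ℝ), 0 < δ ∧ 0 < ρ ∧ 0 < Rw ∧ 0 < cg ∧ 0 < θ₀ ∧ 0 < Rb₁ ∧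
        2 * K * ρ ≤ 1 ∧ ∀ Rb : ℝ, 0 < Rb → Rb ≤ Rb₁ → ∃ Γ₂ : ℝ, ∀ Γ : ℝ, Γ₂ ≤ Γ →
          ∃ (X : Fin N → ℝ → EuclideanSpace ℝ (Fin 3)) (w : Fin N → ℝ → ℝ) (c : Fin N → ℝ) (Aa : Fin N → ℝ → ℝ),
            FlatJ1L N δ ρ K Λ Rw Rb cg θ₀ KA Γ γ α X w c Aa ∧ NearStraightJ1G N Λ Rb X w Aa) :
    Summit.NavierStokesRegularity.NavierStokesRegularity.Theses.FilamentSkeletonRss.TangentSkeletonNearStraightL :=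
  route_tangentSkeletonNearStraightL_iff.mpr (tangentSkeletonNearStraightLS_of_core hcore)

/-! ## The A1G twin (appended 2026-08-31, same hand): the same reduction for `TangentSkeletonNearStraight` (stmt-28295, child 1/3 of `SkeletonJ1G`
27849, through which the A1α aside `SkeletonJ1` 27413 is reached: `skeletonJ1_of_J1G` ∘ `SkeletonJ1GOfNearStraightParts`). -/

/-- **DATUM REDUCTION, A1G heart (structured form `TangentSkeletonNearStraight` of `…SkeletonJ1GSplit`)**: the datum-free core existence statement
for `N ≥ 2`, `(γ, α)` in the `θd`-box (skeletons with `FlatJ1G ∧ NearStraightJ1G`) implies the child; the datum enters only through `N`, `(γ, α)`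
and the box. [folklore] -/
theorem tangentSkeletonNearStraightG_of_core
    (hcore : ∀ (N : ℕ) (θd : ℝ) (γ : Fin N → ℝ) (α : ℝ), 2 ≤ N → 0 < θd →
      (θd ≤ |α| ∧ |α| ≤ θd⁻¹ ∧ ∀ j, θd ≤ |γ j| ∧ |γ j| ≤ θd⁻¹) →
      ∃ (δ ρ K Λ Rw cg θ₀ KA Rb₁ : ℝ), 0 < δ ∧ 0 < ρ ∧ 0 < Rw ∧ 0 < cg ∧ 0 < θ₀ ∧ 0 < Rb₁ ∧
        2 * K * ρ ≤ 1 ∧ ∀ Rb : ℝ, 0 < Rb → Rb ≤ Rb₁ → ∃ Γ₂ : ℝ, ∀ Γ : ℝ, Γ₂ ≤ Γ →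
          ∃ (X : Fin N → ℝ → EuclideanSpace ℝ (Fin 3)) (w : Fin N → ℝ → ℝ) (c : Fin N → ℝ) (Aa : Fin N → ℝ → ℝ),
            FlatJ1G N δ ρ K Λ Rw Rb cg θ₀ KA Γ γ α X w c Aa ∧ NearStraightJ1G N Λ Rb X w Aa) :
    TangentSkeletonNearStraight := by
  intro N δd ρd Λd Rwd θd mw p t γ α s₀ hN hδ hρ hRw hθ hmw hSD hGP
  exact hcore N θd γ α (straightDatum_two_le hδ hN hSD) hθ (straightDatum_paramBox hSD)

/-- The same for the ROUTE decl `Theses.FilamentSkeletonRss.TangentSkeletonNearStraight` (stmt-28295) BY NAME, through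
`route_tangentSkeletonNearStraight_iff`. [folklore] -/
theorem route_tangentSkeletonNearStraightG_of_core
    (hcore : ∀ (N : ℕ) (θd : ℝ) (γ : Fin N → ℝ) (α : ℝ), 2 ≤ N → 0 < θd →
      (θd ≤ |α| ∧ |α| ≤ θd⁻¹ ∧ ∀ j, θd ≤ |γ j| ∧ |γ j| ≤ θd⁻¹) →
      ∃ (δ ρ K Λ Rw cg θ₀ KA Rb₁ : ℝ), 0 < δ ∧ 0 < ρ ∧ 0 < Rw ∧ 0 < cg ∧ 0 < θ₀ ∧ 0 < Rb₁ ∧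
        2 * K * ρ ≤ 1 ∧ ∀ Rb : ℝ, 0 < Rb → Rb ≤ Rb₁ → ∃ Γ₂ : ℝ, ∀ Γ : ℝ, Γ₂ ≤ Γ →
          ∃ (X : Fin N → ℝ → EuclideanSpace ℝ (Fin 3)) (w : Fin N → ℝ → ℝ) (c : Fin N → ℝ) (Aa : Fin N → ℝ → ℝ),
            FlatJ1G N δ ρ K Λ Rw Rb cg θ₀ KA Γ γ α X w c Aa ∧ NearStraightJ1G N Λ Rb X w Aa) :
    Summit.NavierStokesRegularity.NavierStokesRegularity.Theses.FilamentSkeletonRss.TangentSkeletonNearStraight :=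
  route_tangentSkeletonNearStraight_iff.mpr (tangentSkeletonNearStraightG_of_core hcore)

end Summit.NavierStokesRegularity.NavierStokesRegularity.Theorems.TangentSkeletonLDatumReduction

end
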